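import Summits.BirchSwinnertonDyer.BirchSwinnertonDyer.Theorems.QuadraticBranchSignedControlPlusEtaCMRankZeroOfBT26
import Summits.BirchSwinnertonDyer.BirchSwinnertonDyer.Theorems.QuadraticBranchSignedControlPlusEtaCMRowsUpToMu
import Summits.BirchSwinnertonDyer.Rank1Residual.Additive.QuadraticBranchOddStrictExactControlDischarge
import Summits.BirchSwinnertonDyer.Rank1Residual.Additive.QuadraticBranchPlusLFunctionUnique
import Literature.NumberTheory.EllipticCurves.BurungaleTian2026.EtaSignedMainConjectureTensorQ
import HarnessLib

/-!
# Route `QuadraticBranchSignedControl` (rung K8, cell `bsd-potss`), node (C1_η) on the CM rows of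
# ANALYTIC RANK ONE — item stmt-BirchSwinnertonDyer-19114 `PlusMainConjectureBranch` (CM twists) /
# residual crux 19606 `PlusEtaMainConjectureNonsurj` (stub `stub_etaMC_cm`): on a CM Gss2 pair
# `(W, p)` with `r_an(W) = 1`, the route's rank-one Selmer-side main-conjecture input — the EXACT odd
# reading `Char X^{−,str}(W/ℚ_∞) = (X⁻¹ L_p⁻(V, η, X))` — is EQUIVALENT to `BSD_p(W)`, granted the
# route's own declared residual (C2_η-GZ) at the pair and named facts (seat `bsd-potss-k8q-c2` g4)

WHAT. The rank-one twin of `…PlusEtaCMRankZeroOfBT26` (g3, p478801: on CM rank-`0` rows (C1⁺_η)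
follows from named facts, `BSD_p(W)` being Burungale–Flach 2024 there). In analytic rank ONE the
route consumes (C1_η) only through x1b's exact odd reading `h74x` on the strict-minus dual data of
`W` over `ℚ_∞` (`LevelBridge.bsdp_of_plusMC_of_pAdicGrossZagierValuation_of_readings`), together
with its DECLARED RESIDUAL (C2_η-GZ) = item 19116 `PAdicGrossZagierBranch`
(`QuadraticBranchMinusLeadingValuationAt W p 0`: `v_p(coeff₁ L_p⁻) = 2ν + ord_p(#Ш_an·Tam/#tors²)`).
For a CM twin `V`, Burungale–Tian 2026 Thm. 2.6 (named fact `h26`, ODD side: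
`BurungaleTian2026.oddEtaCharIdeal_eq_upToP_of_cm_of_unique`) pins `Char X^{−,str}(W/ℚ_∞)` to
`(p^{a−b})·(L')`, `L_p⁻ = X·L'`; the Selmer-side constant-term count in rank one (x1b GEN 44,
`card_sha_mul_eq_pow_of_oddBranchNoFiniteSubmodule_of_quadraticTwist_signedPrime_rankOne`:
`#Ш(W)[p^∞]·p^{2ν}·∏_T p^{ord_p c_ℓ} = p^{v_p g(0)}` for ANY generator `g`, no main conjecture) and
(C2_η-GZ) then give the DEFECT FORMULA
**`a − b = ord_p #Ш(W)[p^∞] − ord_p #Ш_an(W)`** (§2). Hence (§3) the exact odd reading at a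
strict datum holds IF AND ONLY IF `ord_p #Ш(W)[p^∞] = ord_p #Ш_an(W)`; in particular `BSDp W p` ⟹ the
text of `h74x`'s conclusion at the pair WITHOUT its (C1_η) antecedent. So on the CM rank-one rows of
item 19114 / crux 19606, granted 19116 at the pair and the named facts, the main-conjecture input of the
K8 route is EQUIVALENT to its output `BSD_p(W)`: the `μ`-residual of `stub_etaMC_cm` there (BT26 Rem.
2.7) is `BSD_p`-complete — it is cell `bsd-cm`'s class O10 (CM, additive potentially supersingular,
rank one), and a `BSD_p(W)` obtained by an MC-free road (bsd-cm's route (ζ)) would discharge it.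
§1 records that the ORDER OF VANISHING at `X = 0` survives an equality up to powers of `p`, and §4 the
consequence on every CM row (plus side): `ord_X Char(X⁺(V/K_∞)^η) = ord_X L_p⁺(V, η, X)` from print —
the rank part of (C1⁺_η) on the CM rows is a theorem, like its `λ`-part (p479593); the `μ`-part is not.

HONEST FRAMING (cell `bsd-potss`; FULL-BSD rank ≤ 1 programme, tranche 1b, D-0036/D-0074): THEOREMS
ONLY — no definition, no new named fact, no `sorry`, axioms standard. CONDITIONAL on the displayed
hypotheses: named facts `h26` (BT26 Thm. 2.6 ∘ Kob03; NOT proved in the tree), `h22`, `hPT`, `hmod`; the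
cell's typed READING (R2) `OddBranchStrictMinusNoFiniteSubmoduleAt W p` (Kitajima–Otsuki Main Thm. 1.3,
sign `−`); the route's residual (C2_η-GZ) AT THE PAIR (item 19116, an EVIDENCE item, in no source); and,
where stated, `BSDp W p` (for a CM curve of analytic rank one with ADDITIVE reduction at `p` NOT in
print). Items 19114, 19606, 19116 and `stub_etaMC_cm` stay OPEN; nothing is booked; BSD is not proved
for any curve by this. `--supports stmt-BirchSwinnertonDyer-19606` (bears on 19114's CM rows).

References: [BurungaleTian2026] Thm. 2.6 and Rem. 2.7 (p. 5); [Kobayashi2003] §4 odd main conjecture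
(p. 8), Thm. 2.2 (p. 5), Thm. 7.4 (p. 13), Thm. 9.3 (p. 26), (3.7) (p. 7); [KitajimaOtsuki2018] Main
Thm. 1.3; [GreenbergLNM1716] §4 Thm. 4.1, Lemma 4.2 (p. 102); [MilneADT2006] I Thm. 4.10;
[Miller2011LMS] §1, Def. 1.1; [Washington1997] §7.1, §13.2.
-/

set_option linter.dupNamespace false

noncomputable section

open scoped Classical MatrixGroups ModularForm
open CongruenceSubgroup Field Function NumberField IsDedekindDomain WeierstrassCurve
open Literature.NumberTheory.EllipticCurves Literature.NumberTheory.EllipticCurves.ModularForms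
open Literature.NumberTheory.EllipticCurves.Rank1Residual Literature.NumberTheory.EllipticCurves.Rank1Residual.Typed
open Literature.NumberTheory.GaloisRepresentations Literature.NumberTheory.GaloisCohomology
open Literature.NumberTheory.EllipticCurves.IwasawaAlgebra Literature.NumberTheory.EllipticCurves.IwasawaDual
open ZpExtension Summit.BirchSwinnertonDyer.Rank1Residual.Additive
open Summit.BirchSwinnertonDyer.Rank1Residual.Additive.LevelBridge

namespace Summit.BirchSwinnertonDyer.BirchSwinnertonDyer.Theorems

namespace EtaCMRankOneBT26

/-! ## §1 Order of vanishing and leading coefficient along `(p^b)·(g) = (p^a)·(L)` in `Λ = ℤ_p⟦X⟧` -/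

section Algebra

variable {p : ℕ} [hp : Fact p.Prime]

/-- `p^k = C(p^k)` in `Λ`. [folklore] -/
private theorem natCast_pow_eq_C (k : ℕ) :
    ((p : IwasawaAlgebra p) ^ k) = PowerSeries.C ((p : ℤ_[p]) ^ k) := by
  rw [map_pow, map_natCast]

/-- `p^a ≠ 0` in `Λ`. [folklore] -/
private theorem natCast_pow_ne_zero (a : ℕ) : ((p : IwasawaAlgebra p) ^ a) ≠ 0 := by
  rw [← map_natCast (PowerSeries.C (R := ℤ_[p])) p]
  exact pow_ne_zero _ (prime_C p).ne_zero

/-- A power series with non-zero constant term has order `0`. [folklore] -/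
private theorem order_eq_zero_of_constantCoeff_ne_zero {g : IwasawaAlgebra p}
    (h : PowerSeries.constantCoeff g ≠ 0) : g.order = 0 := by
  by_contra h0
  exact h (PowerSeries.order_ne_zero_iff_constCoeff_eq_zero.mp h0)

/-- `ord_X (p^k) = 0` in `Λ`. [folklore] -/
private theorem order_natCast_pow (k : ℕ) : ((p : IwasawaAlgebra p) ^ k).order = 0 := by
  refine order_eq_zero_of_constantCoeff_ne_zero ?_
  rw [natCast_pow_eq_C, PowerSeries.constantCoeff_C]
  exact pow_ne_zero _ (by exact_mod_cast hp.out.ne_zero)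

/-- **The order of vanishing at `X = 0` is blind to powers of `p` and to units**: if
`(p^b)·(g) = (p^a)·(L)` as ideals of `Λ` with `g, L ≠ 0`, then `ord_X g = ord_X L` — the rank part of
an "equality up to powers of `p`" is an honest equality. [cite: Washington1997, §7.1] -/
theorem order_eq_of_upToP {g L : IwasawaAlgebra p} {a b : ℕ}
    (hab : Ideal.span {(p : IwasawaAlgebra p) ^ b} * Ideal.span {g} =
      Ideal.span {(p : IwasawaAlgebra p) ^ a} * Ideal.span {L}) :
    g.order = L.order := by
  rw [Ideal.span_singleton_mul_span_singleton, Ideal.span_singleton_mul_span_singleton,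
    Ideal.span_singleton_eq_span_singleton] at hab
  obtain ⟨u, hu⟩ := hab
  have hou : (u : IwasawaAlgebra p).order = 0 :=
    order_eq_zero_of_constantCoeff_ne_zero (u.isUnit.map PowerSeries.constantCoeff).ne_zero
  have h := congrArg PowerSeries.order hu
  rw [PowerSeries.order_mul, PowerSeries.order_mul, PowerSeries.order_mul, hou, order_natCast_pow,
    order_natCast_pow, add_zero, zero_add, zero_add] at h
  exact h

end Algebra

/-! ## §2 Per CM pair of analytic rank one, per strict-minus datum of `W`: the defect formula -/

section PerPair

variable (W : WeierstrassCurve ℚ) [W.IsElliptic] [W.IsGloballyMinimal] (p : ℕ) [hp : Fact p.Prime]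

/-- **THE DEFECT FORMULA on a CM pair of analytic rank one.** `W` globally minimal, `p ≥ 5`,
`C • W^{(p*)} = V` good at `p`, `a_p(V) = 0`, `V` CM, `r_an(W) = 1`, newform `f`, period ratio `ϖ`, `L`
with the interpolation property of `L_p⁻(V, η, X)`, `W(ℚ_p)[p] = 0`, generator `P` of level `n`,
`#Ш_an(W) = s ≠ 0`, `Ш(W)[p^∞]` finite, cyclotomic `κ`, `γ`, a strict-minus datum `D`, `L = X·L'`. Then
`(p^b)·Char(D.X) = (p^a)·(L')` for some `a b` — Burungale–Tian's odd statement at `η` read on `D`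
through x1b's dictionary `D.toEtaSigned` (SAME module and characteristic ideal; the fact's `huniq`
DISCHARGED by `IsQuadraticBranchMinusLFunction.span_singleton_eq`) — AND **`b + ord_p #Ш(W)[p^∞] =
a + ord_p s`**: `b + v_p(g(0)) = a + v_p(L'(0))` for a generator `g` (g3's lemma), `v_p(g(0)) =
ord_p #Ш[p^∞] + 2n + ord_p Tam` (x1b's rank-one count, no main conjecture), `v_p(L'(0)) = 2n +
ord_p(s·Tam/#tors²)` ((C2_η-GZ)). CONDITIONAL on `h26`, `h22`, `hPT`, (R2), (C2_η-GZ); nothing booked.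
[cite: BurungaleTian2026, Thm. 2.6 and Rem. 2.7 (p. 5)] [cite: Kobayashi2003, §4 (p. 8), Thm. 2.2 (p. 5), (3.7) (p. 7), Thm. 9.3 (p. 26)]
[cite: KitajimaOtsuki2018, Main Thm. 1.3 (arXiv:1607.03612 p. 3)] [cite: GreenbergLNM1716, §4 Lemma 4.2 (p. 102)] -/
theorem exists_upToP_and_defect_of_bt26_of_hasCM_rankOne
    (h26 : BurungaleTian2026.thm26_etaKatoSequences_charIdeal_upToP_of_cm)
    (h22 : Kobayashi2003.thm22_etaSignedSelmerDual_finite_torsion)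
    (hPT : poitouTate_selmerStructure_duality_real ℚ)
    (hR2 : OddBranchStrictMinusNoFiniteSubmoduleAt W p)
    (h2 : QuadraticBranchMinusLeadingValuationAt W p 0)
    (V : WeierstrassCurve ℚ) [V.IsElliptic] [V.IsGloballyMinimal] (C : VariableChange ℚ)
    {N : ℕ} [NeZero N] {f : CuspForm (Gamma0 N) 2}
    (hp5 : 5 ≤ p) (hCV : C • W.quadraticTwist ((-1) ^ (p / 2) * p) = V)
    (hgood : V.HasGoodReductionAtPrime p) (hap : V.frobeniusTrace p = 0) (hCM : V.HasCM)
    (hr : W.analyticRank = 1) (hf : IsNewformOf V f) (ϖ : ℚ)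
    (hϖ : if Even (p / 2) then (ϖ : ℝ) * V.realPeriodRat = plusPeriod f
      else (ϖ : ℝ) * V.imaginaryPeriodRat = minusPeriod f)
    (L : IwasawaAlgebra p) (hL : IsQuadraticBranchMinusLFunction f p ϖ L)
    (htors : ∀ Q : (W.baseChange ℚ_[p]).toAffine.Point, p • Q = 0 → Q = 0)
    (P : W.toAffine.Point) (n : ℕ) (hP : ¬ IsOfFinAddOrder P)
    (hgen : ∀ R : W.toAffine.Point, ∃ (k : ℤ) (T : W.toAffine.Point), IsOfFinAddOrder T ∧ R = k • P + T)
    (hdiv : ∃ Q : (W.baseChange ℚ_[p]).toAffine.Point, p ^ n • Q = W.toPadicPoint p P)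
    (hndiv : ∀ Q : (W.baseChange ℚ_[p]).toAffine.Point, p ^ (n + 1) • Q ≠ W.toPadicPoint p P)
    (s : ℚ) (hs : shaAn W = (s : ℂ)) (hs0 : s ≠ 0)
    [hSha : Finite (AddCommGroup.primaryComponent W.sha p)]
    {κ : ZpExtension ℚ p} {γ : absoluteGaloisGroup ℚ} (hκ : κ.IsCyclotomic)
    (hγ : κ.IsTopGenerator γ) (hγc : IsCyclotomicVariable p γ)
    (D : StrictSignedSelmerDualData W κ ℚ_[p] γ (-1)) (L' : IwasawaAlgebra p)
    (hLL' : L = PowerSeries.X * L') :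
    ∃ a b : ℕ, Ideal.span {(p : IwasawaAlgebra p) ^ b} * D.charIdeal =
        Ideal.span {(p : IwasawaAlgebra p) ^ a} * Ideal.span {L'} ∧
      (b : ℤ) + padicValNat p (Nat.card (AddCommGroup.primaryComponent W.sha p)) = a + padicValRat p s := by
  have hp2 : p ≠ 2 := by omega
  -- x1b's dictionary: read `D` as an `η`-minus datum of `V` over `K₀ = ℚ(μ_p)` (same module)
  haveI : NeZero p := ⟨hp.out.ne_zero⟩
  haveI : IsCyclotomicExtension {p} ℚ (CyclotomicField p ℚ) :=
    CyclotomicField.isCyclotomicExtension p ℚ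
  haveI : (galRange (K := ℚ) (CyclotomicField p ℚ)).Normal := normal_galRange_cyclotomic p _
  obtain ⟨θ, ηθ, hθ, hc, hη, hηK, hη1⟩ := SignedTwist.exists_theta_eta_cyclotomicField p hp2
  have hD := SignedTwist.localTowerHyp_padic p κ (CyclotomicField p ℚ) hκ
  have hκ₀ := kappa_surjOn_galRange_cyclotomic κ (CyclotomicField p ℚ)
  have hcop := coprime_index_galRange_cyclotomic p (CyclotomicField p ℚ)
  obtain ⟨γ', hγ'K, hγ'κ⟩ := hκ₀ (κ γ)
  have hγγ' : γ⁻¹ * γ' ∈ κ.kerSubgroup := by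
    rw [ZpExtension.mem_kerSubgroup, map_mul, map_inv, hγ'κ, inv_mul_cancel]
  have hγ' : κ.IsTopGenerator γ' := by rw [ZpExtension.IsTopGenerator, hγ'κ]; exact hγ
  have hγ'c : IsCyclotomicVariable p γ' := SignedTwist.isCyclotomicVariable_of_inv_mul_mem_ker hκ hγγ' hγc
  -- Burungale–Tian, ODD side at `η`, on that datum (its `huniq` discharged)
  obtain ⟨a, b, hab⟩ := BurungaleTian2026.oddEtaCharIdeal_eq_upToP_of_cm_of_unique h26 h22
    (CyclotomicField p ℚ) ηθ hηK hη1 V hp2 hCM hgood hap hf ϖ hϖ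
    (fun _ _ h₁ h₂ => IsQuadraticBranchMinusLFunction.span_singleton_eq (f := f) hp2 h₁ h₂)
    κ γ' hκ hγ' hγ'K hγ'c L hL L' hLL'
    (D.toEtaSigned W (CyclotomicField p ℚ) hθ hc p κ hCV ηθ hη ℚ_[p] hD hκ₀ hcop hγ'K hγγ').toLiterature
  rw [EtaSignedSelmerDualData.charIdeal_toLiterature, StrictSignedSelmerDualData.toEtaSigned_charIdeal] at hab
  refine ⟨a, b, hab, ?_⟩
  -- a generator `g` of `Char(D.X)`
  obtain ⟨g, hg0, hg⟩ := BurungaleTian2026.exists_charIdeal_eq_span_ne_zero (p := p) D.X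
  have hgD : D.charIdeal = Ideal.span {g} := hg
  have habg : Ideal.span {(p : IwasawaAlgebra p) ^ b} * Ideal.span {g} =
      Ideal.span {(p : IwasawaAlgebra p) ^ a} * Ideal.span {L'} := by rw [← hgD]; exact hab
  set v₀ := (Rat.HeightOneSpectrum.primesEquiv (R := 𝓞 ℚ)).symm ⟨p, hp.out⟩ with hv₀
  -- the exceptional set `T`
  obtain ⟨S, hS⟩ := exists_finset_forall_not_mem_good W p
  have hpT : v₀ ∉ S.erase v₀ := fun h ↦ (Finset.mem_erase.mp h).1 rfl
  have hTmem : ∀ v : HeightOneSpectrum (𝓞 ℚ), v ≠ v₀ →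
      p ∣ (W.baseChange (v.adicCompletion ℚ)).localTamagawaNumber (v.adicCompletionIntegers ℚ) →
        v ∈ S.erase v₀ := by
    intro v hv hdvd
    refine Finset.mem_erase.mpr ⟨hv, ?_⟩
    by_contra hvS
    rw [W.localTamagawaNumber_eq_one_of_hasGoodReductionAt_holds v (hS v hvS).2] at hdvd
    exact hp.out.one_lt.ne' (Nat.dvd_one.mp hdvd)
  -- Selmer side for the generator `g`: `#Ш[p^∞] · (p^{2n} · ∏_T p^{ord_p c_ℓ}) = p^{ord_p g(0)}`
  have hSel := card_sha_mul_eq_pow_of_oddBranchNoFiniteSubmodule_of_quadraticTwist_signedPrime_rankOne W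
    κ hp2 hκ C V hCV hgood hap hPT P hP hgen hdiv hndiv (S.erase v₀) hpT hTmem hγ D hgD hR2
  -- analytic side: (C2_η-GZ) at the pair, `L'(0) = coeff₁ L ≠ 0`
  obtain ⟨hne, hv2⟩ := h2 V C hp5 hCV hgood hap hr hf ϖ hϖ L hL htors P n hP hgen hdiv hndiv s hs
  have hL'0 : PowerSeries.constantCoeff L' = PowerSeries.coeff 1 L := by
    rw [hLL', PowerSeries.coeff_succ_X_mul, PowerSeries.coeff_zero_eq_constantCoeff]
  have hL'ne : PowerSeries.constantCoeff L' ≠ 0 := by rw [hL'0]; exact hne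
  -- constant terms along `(p^b)·(g) = (p^a)·(L')`: `b + v_p(g(0)) = a + v_p(L'(0))`
  obtain ⟨-, hvals⟩ := EtaCMRankZeroBT26.constantCoeff_ne_zero_and_valuation_add_eq_of_upToP habg hL'ne
  -- §0 bookkeeping (x1b): `∑_T ord_p c_ℓ = ord_p Tam`, `p ∤ #tors`
  have hv0 := padicValNat_localTamagawaNumber_eq_zero_of_quadraticTwist_signedPrime W p hp5 C V hCV hgood
  have hTamSum := sum_padicValNat_localTamagawaNumber_eq_padicValNat_tamagawaProduct W p (S.erase v₀) hpT
    hTmem hv0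
  have htors0 := padicValNat_torsionOrder_eq_zero_of_noPTorsion W p htors
  have hSha0 : Nat.card (AddCommGroup.primaryComponent W.sha p) ≠ 0 := Nat.card_pos.ne'
  have hp0 : p ≠ 0 := hp.out.ne_zero
  rw [Finset.prod_pow_eq_pow_sum, ← pow_add, hTamSum] at hSel
  have hval := congrArg (padicValNat p) hSel
  rw [padicValNat.mul hSha0 (pow_ne_zero _ hp0), padicValNat.prime_pow, padicValNat.prime_pow] at hval
  have hTamQ : (W.tamagawaProduct : ℚ) ≠ 0 := by exact_mod_cast W.tamagawaProduct_pos_holds.ne'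
  have htQ : (W.torsionOrder : ℚ) ≠ 0 := by exact_mod_cast W.torsionOrder_pos_holds.ne'
  have hrat : padicValRat p (s * W.tamagawaProduct / (W.torsionOrder : ℚ) ^ 2) =
      padicValRat p s + (padicValNat p W.tamagawaProduct : ℤ) := by
    rw [padicValRat.div (mul_ne_zero hs0 hTamQ) (pow_ne_zero 2 htQ), padicValRat.mul hs0 hTamQ,
      padicValRat.pow, padicValRat.of_nat, padicValRat.of_nat, htors0]
    simp
  -- valuations of `g(0)` and `L'(0)` as integers
  rw [PadicInt.valuation_coe, Int.toNat_natCast] at hval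
  rw [← hL'0, PadicInt.valuation_coe, hrat] at hv2
  have hvalZ : (padicValNat p (Nat.card (AddCommGroup.primaryComponent W.sha p)) : ℤ) +
      (2 * (n : ℤ) + (padicValNat p W.tamagawaProduct : ℤ)) =
        ((PowerSeries.constantCoeff g).valuation : ℤ) := by
    exact_mod_cast hval
  have hz : (b : ℤ) + ((PowerSeries.constantCoeff g).valuation : ℤ) =
      a + ((PowerSeries.constantCoeff L').valuation : ℤ) := by
    exact_mod_cast hvals
  linarith

/-! ## §3 On the CM rank-one rows: the exact odd reading ⟺ `ord_p #Ш(W)[p^∞] = ord_p #Ш_an(W)` -/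

/-- **On a CM Gss2 pair of analytic rank one the exact odd reading IS `BSD_p(W)`'s valuation
clause** (per strict datum). Frame of `exists_upToP_and_defect_of_bt26_of_hasCM_rankOne`; conclusion:
`Char(D.X) = (L')` IF AND ONLY IF `ord_p #Ш(W)[p^∞] = ord_p s` (`#Ш_an(W) = s`). ⟹: with `Char = (L')`
the relation reads `(p^b)·(L') = (p^a)·(L')`, so `a = b` (constant terms, `L'(0) = coeff₁ L ≠ 0`) and the
defect formula gives the valuation clause (the per-datum form of the route's own chain). ⟸: the defect
formula gives `a = b`, and `(p^a)` cancels.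
CONDITIONAL on `h26`, `h22`, `hPT`, (R2), (C2_η-GZ) at the pair; nothing booked; neither side is
claimed. [cite: BurungaleTian2026, Thm. 2.6 and Rem. 2.7 (p. 5)] [cite: Kobayashi2003, §4 (p. 8), Thm. 7.4 (p. 13), Thm. 9.3 (p. 26)]
[cite: Miller2011LMS, §1 and Def. 1.1] -/
theorem charIdeal_eq_iff_padicValNat_card_sha_eq_of_bt26_of_hasCM_rankOne
    (h26 : BurungaleTian2026.thm26_etaKatoSequences_charIdeal_upToP_of_cm)
    (h22 : Kobayashi2003.thm22_etaSignedSelmerDual_finite_torsion)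
    (hPT : poitouTate_selmerStructure_duality_real ℚ)
    (hR2 : OddBranchStrictMinusNoFiniteSubmoduleAt W p)
    (h2 : QuadraticBranchMinusLeadingValuationAt W p 0)
    (V : WeierstrassCurve ℚ) [V.IsElliptic] [V.IsGloballyMinimal] (C : VariableChange ℚ)
    {N : ℕ} [NeZero N] {f : CuspForm (Gamma0 N) 2}
    (hp5 : 5 ≤ p) (hCV : C • W.quadraticTwist ((-1) ^ (p / 2) * p) = V)
    (hgood : V.HasGoodReductionAtPrime p) (hap : V.frobeniusTrace p = 0) (hCM : V.HasCM)
    (hr : W.analyticRank = 1) (hf : IsNewformOf V f) (ϖ : ℚ)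
    (hϖ : if Even (p / 2) then (ϖ : ℝ) * V.realPeriodRat = plusPeriod f
      else (ϖ : ℝ) * V.imaginaryPeriodRat = minusPeriod f)
    (L : IwasawaAlgebra p) (hL : IsQuadraticBranchMinusLFunction f p ϖ L)
    (htors : ∀ Q : (W.baseChange ℚ_[p]).toAffine.Point, p • Q = 0 → Q = 0)
    (P : W.toAffine.Point) (n : ℕ) (hP : ¬ IsOfFinAddOrder P)
    (hgen : ∀ R : W.toAffine.Point, ∃ (k : ℤ) (T : W.toAffine.Point), IsOfFinAddOrder T ∧ R = k • P + T)
    (hdiv : ∃ Q : (W.baseChange ℚ_[p]).toAffine.Point, p ^ n • Q = W.toPadicPoint p P)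
    (hndiv : ∀ Q : (W.baseChange ℚ_[p]).toAffine.Point, p ^ (n + 1) • Q ≠ W.toPadicPoint p P)
    (s : ℚ) (hs : shaAn W = (s : ℂ)) (hs0 : s ≠ 0)
    [hSha : Finite (AddCommGroup.primaryComponent W.sha p)]
    {κ : ZpExtension ℚ p} {γ : absoluteGaloisGroup ℚ} (hκ : κ.IsCyclotomic)
    (hγ : κ.IsTopGenerator γ) (hγc : IsCyclotomicVariable p γ)
    (D : StrictSignedSelmerDualData W κ ℚ_[p] γ (-1)) (L' : IwasawaAlgebra p)
    (hLL' : L = PowerSeries.X * L') :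
    D.charIdeal = Ideal.span {L'} ↔
      (padicValNat p (Nat.card (AddCommGroup.primaryComponent W.sha p)) : ℤ) = padicValRat p s := by
  obtain ⟨a, b, hab, hdef⟩ := exists_upToP_and_defect_of_bt26_of_hasCM_rankOne W p h26 h22 hPT hR2 h2
    V C hp5 hCV hgood hap hCM hr hf ϖ hϖ L hL htors P n hP hgen hdiv hndiv s hs hs0 hκ hγ hγc D L' hLL'
  constructor
  · -- `Char = (L')` ⟹ `(p^b)·(L') = (p^a)·(L')` ⟹ `a = b` (constant terms, `L'(0) = coeff₁ L ≠ 0`)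
    intro hchar
    obtain ⟨hne, -⟩ := h2 V C hp5 hCV hgood hap hr hf ϖ hϖ L hL htors P n hP hgen hdiv hndiv s hs
    have hL'ne : PowerSeries.constantCoeff L' ≠ 0 := by
      rw [hLL', PowerSeries.coeff_succ_X_mul, PowerSeries.coeff_zero_eq_constantCoeff] at hne; exact hne
    rw [hchar] at hab
    obtain ⟨-, hvals⟩ := EtaCMRankZeroBT26.constantCoeff_ne_zero_and_valuation_add_eq_of_upToP hab hL'ne
    have hab_eq : (a : ℤ) = b := by have := Nat.add_right_cancel hvals; exact_mod_cast this.symm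
    linarith
  · intro hBSD
    have hab_eq : a = b := by
      rw [hBSD] at hdef
      have : (b : ℤ) = a := by linarith
      exact_mod_cast this.symm
    subst hab_eq
    exact (Ideal.span_singleton_mul_right_inj (natCast_pow_ne_zero a)).mp hab

/-- **THE EXACT ODD READING ON A CM RANK-ONE PAIR FROM `BSD_p(W)`** — the text of the conclusion of
the route's rank-one Selmer-side input `h74x` (x1b, `LevelBridge.bsdp_of_plusMC_of_pAdicGrossZagierValuation_of_readings`)
at the pair `(W, p)` with the good CM twin `V`, WITHOUT its (C1_η) antecedent: for every newform, period
ratio, `L` with the interpolation property of `L_p⁻(V, η, X)`, cyclotomic `κ`, generator `γ` matching the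
variable, every strict-minus dual datum `D` and `L = X·L'`: `Char(D.X) = (L')`. INPUTS (hypothesis
position): named facts `h26`, `h22`, `hPT`, `hmod` (for `#Ш_an ≠ 0`); the typed reading (R2); the route's residual (C2_η-GZ) AT THE PAIR (item 19116); and `BSDp W p` — for a CM curve of analytic rank one
with additive reduction at `p` NOT a theorem in print (cell bsd-cm's class O10). CONDITIONAL; closes
nothing; nothing booked. [cite: BurungaleTian2026, Thm. 2.6 and Rem. 2.7 (p. 5)]
[cite: Kobayashi2003, §4 odd main [C] (p. 8), Thm. 7.4 (p. 13), Thm. 2.2 (p. 5), (3.7) (p. 7)]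
[cite: Miller2011LMS, §1 and Def. 1.1] [cite: SilvermanAEC2009, Prop. VII.6.3 and Thm. VIII.6.7] -/
theorem strictOddReading_of_bsdp_of_bt26_of_hasCM_rankOne
    (h26 : BurungaleTian2026.thm26_etaKatoSequences_charIdeal_upToP_of_cm)
    (h22 : Kobayashi2003.thm22_etaSignedSelmerDual_finite_torsion)
    (hPT : poitouTate_selmerStructure_duality_real ℚ) (hmod : hasEntireLFunction_rat)
    (hR2 : OddBranchStrictMinusNoFiniteSubmoduleAt W p)
    (h2 : QuadraticBranchMinusLeadingValuationAt W p 0)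
    (V : WeierstrassCurve ℚ) [V.IsElliptic] [V.IsGloballyMinimal] (C : VariableChange ℚ)
    (hp5 : 5 ≤ p) (hCV : C • W.quadraticTwist ((-1) ^ (p / 2) * p) = V)
    (hgood : V.HasGoodReductionAtPrime p) (hap : V.frobeniusTrace p = 0) (hCM : V.HasCM)
    (hr : W.analyticRank = 1) (hB : BSDp W p) :
    ∀ {N : ℕ} [NeZero N] {f : CuspForm (Gamma0 N) 2}, IsNewformOf V f →
    ∀ (ϖ : ℚ), (if Even (p / 2) then (ϖ : ℝ) * V.realPeriodRat = plusPeriod f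
        else (ϖ : ℝ) * V.imaginaryPeriodRat = minusPeriod f) →
    ∀ (L : IwasawaAlgebra p), IsQuadraticBranchMinusLFunction f p ϖ L →
    ∀ (κ : ZpExtension ℚ p) (γ : absoluteGaloisGroup ℚ),
      κ.IsCyclotomic → κ.IsTopGenerator γ → IsCyclotomicVariable p γ →
    ∀ (D : StrictSignedSelmerDualData W κ ℚ_[p] γ (-1)) (L' : IwasawaAlgebra p),
      L = PowerSeries.X * L' → D.charIdeal = Ideal.span {L'} := by
  intro N _ f hf ϖ hϖ L hL κ γ hκ hγ hγc D L' hLL'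
  -- `BSD_p(W)`: rank one, `Ш[p^∞]` finite, `ord_p #Ш_an = ord_p #Ш[p^∞]`
  obtain ⟨hrank, hfin, s, hs, hv⟩ := hB
  haveI := hfin
  have hs0 : s ≠ 0 := by
    rintro rfl
    exact Summit.BirchSwinnertonDyer.Rank1Residual.AdditivePotMult.shaAn_ne_zero W hmod
      (by rw [hs, Rat.cast_zero])
  -- the rank-one data: a generator of `W(ℚ)` modulo torsion and its exact level in `W(ℚ_p)`;
  -- `W(ℚ_p)[p] = 0` for the `p*`-twist of a good `a_p = 0` curve
  have hrank1 : W.mordellWeilRank = 1 := by rw [hrank, hr]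
  obtain ⟨P, n, hP, hgen, hdiv, hndiv⟩ :=
    exists_generator_and_level_of_mordellWeilRank_eq_one (p := p) W hrank1
  have htors : ∀ Q : (W.baseChange ℚ_[p]).toAffine.Point, p • Q = 0 → Q = 0 :=
    eq_zero_of_prime_smul_eq_zero_padic_of_quadraticTwist_goodSupersingular (by omega) W C V hCV hgood hap
  exact (charIdeal_eq_iff_padicValNat_card_sha_eq_of_bt26_of_hasCM_rankOne W p h26 h22 hPT hR2 h2 V C hp5
    hCV hgood hap hCM hr hf ϖ hϖ L hL htors P n hP hgen hdiv hndiv s hs hs0 hκ hγ hγc D L' hLL').mpr hv.symm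

end PerPair

/-! ## §4 The plus side on EVERY CM row: the order of vanishing at `X = 0` of `Char(X⁺(V/K_∞)^η)` is
that of `L_p⁺(V, η, X)` -/

section Order

variable {p : ℕ} [hp : Fact p.Prime] {V : WeierstrassCurve ℚ} [V.IsElliptic] [V.IsGloballyMinimal]

/-- **`ord_X Char(X⁺(V/K_∞)^η) = ord_X L_p⁺(V, η, X)` for a CM twist** (kernel, every analytic rank):
for `V/ℚ` CM, globally minimal, good at the odd `p` with `a_p(V) = 0`, on the binders of the node
`QuadraticBranchPlusEtaMainConjectureAt V p` and for EVERY `η`-datum `D` with `Char(D.X) = (g)`: the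
order of vanishing of `g` at `X = 0` equals that of `Lη` — from Burungale–Tian's
`(p^b)·Char(D.X) = (p^a)·(Lη)` (g3's `EtaCMUpToMu.charIdeal_upToP_of_cm`, named facts `h26` + `h22`)
and §1: powers of `p` and units do not vanish at `X = 0`. So on the CM rows the "rank part" of
Kobayashi's even main conjecture at `η` is a THEOREM from print (like the `λ`-part, p479593); only the
`μ`-part is not. CONDITIONAL on `h26`, `h22`; nothing booked.
[cite: BurungaleTian2026, Thm. 2.6 and Rem. 2.7 (p. 5)] [cite: Kobayashi2003, §4 Even main [C] (p. 8), Thm. 2.2 (p. 5)]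
[cite: Washington1997, §7.1] -/
theorem order_charGenerator_eq_order_of_cm
    (h26 : BurungaleTian2026.thm26_etaKatoSequences_charIdeal_upToP_of_cm)
    (h22 : Kobayashi2003.thm22_etaSignedSelmerDual_finite_torsion) (hCM : V.HasCM)
    {K₀ : Type} [Field K₀] [NumberField K₀] [IsCyclotomicExtension {p} ℚ K₀]
    [(galRange (K := ℚ) K₀).Normal] {ηq : absoluteGaloisGroup ℚ →* ℤˣ}
    (hηK : ∀ σ ∈ galRange (K := ℚ) K₀, ηq σ = 1) (hη1 : ηq ≠ 1)
    {N : ℕ} [NeZero N] {f : CuspForm (Gamma0 N) 2}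
    (hp2 : p ≠ 2) (hgood : V.HasGoodReductionAtPrime p) (hap : V.frobeniusTrace p = 0)
    (hf : IsNewformOf V f) (ϖ : ℚ)
    (hϖ : if Even (p / 2) then (ϖ : ℝ) * V.realPeriodRat = plusPeriod f
      else (ϖ : ℝ) * V.imaginaryPeriodRat = minusPeriod f)
    (Lη : IwasawaAlgebra p) (hL : IsQuadraticBranchPlusLFunction f p ϖ Lη)
    {κ : ZpExtension ℚ p} {γ : absoluteGaloisGroup ℚ} (hκ : κ.IsCyclotomic)
    (hγ : κ.IsTopGenerator γ) (hγK : γ ∈ galRange (K := ℚ) K₀) (hγc : IsCyclotomicVariable p γ)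
    (D : EtaSignedSelmerDualData V κ K₀ ℚ_[p] ηq γ 1) {g : IwasawaAlgebra p}
    (hg : D.charIdeal = Ideal.span {g}) : g.order = Lη.order := by
  obtain ⟨a, b, hab⟩ := EtaCMUpToMu.charIdeal_upToP_of_cm h26 h22 hCM hηK hη1 hp2 hgood hap hf ϖ hϖ Lη
    hL hκ hγ hγK hγc D
  rw [hg] at hab
  exact order_eq_of_upToP hab

end Order

end EtaCMRankOneBT26

end Summit.BirchSwinnertonDyer.BirchSwinnertonDyer.Theorems

end
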